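import Mathlib
import Summits.ValiantsHypothesis.ValiantsHypothesis.Theorems.GeneratorObstructionsGenFlipThesisSliceTransfer
import Summits.ValiantsHypothesis.ValiantsHypothesis.Theorems.GeneratorObstructionsPerGenDegreeSuperQPAtomCertificates

/-!
# Route GeneratorObstructions — crux K2 `PowGenDegreeQP` (stmt-ValiantsHypothesis-11655), line
# `trace-side-regimes`: structure of the WIDE regime and losslessness of the split

Helper file (`--supports stmt-ValiantsHypothesis-11655`) for the registered line
`Cruxes/GenFlipThesis/Lines/trace_side_regimes.lean` of K2, whose two stubs split the generator types
`χ` of `A(Δ_m[tr X_n^m])` (`n = m + e` inside the window `n ≤ 2^((log₂ m + c)^c)`) by SUPPORT: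
`stub_sliceGen` (weights extended by zero from the final `m²` letters `ι`) and `stub_wideGen`
(weights with a nonzero entry OFF `range ι`).

Proved here, sorry-free, no definitions:

1. `ne_bot_of_finrank_quotient_ne_zero` — a generator type occurs (`γ_χ ≠ 0 → HWV_χ ≠ ⊥`);
2. `card_image_lt_card_filter_ne_zero` — for a dominant nonpositive weight (occurring weights are
   such, tree `isDominant_of_hasHighestWeight_orbitCoordRep`,
   `nonpos_and_exists_size_eq_of_hasHighestWeight_orbitCoordRep`) the support is an upper set, so a
   nonzero entry off the upper set `range ι` forces `range ι ⊊ supp χ`;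
3. **the wide regime lives beyond degree `m²`** (`sq_lt_card_filter_ne_zero_of_wide`,
   `wide_degree_ge`): a wide OCCURRING weight of `ℂ[Δ_m[tr X_{m+e}^m]]` has more than `m²` nonzero
   entries, hence (tree `card_filter_ne_zero_le_degree`, `ℓ(λ) ≤ deg`, Macdonald I.8 Ex. 9) degree
   `-|χ|/m ≥ m² + 1`; in particular the wide regime is EMPTY at the bottom size `e = 0`
   (`not_wide_of_e_eq_zero`) and a wide generator type never has quasi-polynomial degree for a
   trivial reason — the stub's bound must absorb degrees `≥ m² + 1`;
4. **ι-free form of `stub_wideGen`** (`wideGen_iff_card`): the registered stub is equivalent to the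
   same bound for all weights with MORE THAN `m²` nonzero entries (no final segment mentioned);
5. **the split is lossless** (`powGenDegreeQP_iff_slice_and_wide`): K2 ⟺ `stub_sliceGen ∧
   stub_wideGen` (hypotheses verbatim) — `⇒` by the landed `sliceGen_of_powGenDegreeQP` and weakening,
   `⇐` is the skeleton's case split `χ = ext_ι (χ ∘ ι)` or wide.

Honest framing: structure lemmas and bookkeeping; `stub_sliceGen`, `stub_wideGen`, K2, K1 and
`GenFlipThesis` remain OPEN (conjecture-grade), and nothing here bears on `VP ≠ VNP`.

References: Macdonald, *Symmetric functions and Hall polynomials* (1995) I.8 Ex. 9;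
Bürgisser–Landsberg–Manivel–Weyman, SIAM J. Comput. 40 (2011) §4.4, (5.2.2);
Gesmundo–Ikenmeyer–Panova, Diff. Geom. Appl. 55 (2017) §2.2.
-/

namespace Summit.ValiantsHypothesis.ValiantsHypothesis.Theorems.GeneratorObstructions.PowGenDegreeQP

open MvPolynomial
open Literature.NumberTheory.DiophantineGeometry Literature.Computability.AlgebraicComplexity
open Summit.ValiantsHypothesis.ValiantsHypothesis.Theses.GeneratorObstructions
open Summit.ValiantsHypothesis.ValiantsHypothesis.Theorems.GenInheritance
open Summit.ValiantsHypothesis.ValiantsHypothesis.Theorems.GeneratorObstructions.SliceTransfer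
open Summit.ValiantsHypothesis.ValiantsHypothesis.Theorems.GeneratorObstructions.PerGenDegreeSuperQP

-- `Summit.ValiantsHypothesis.ValiantsHypothesis.…` is the tree's mandated single-conjunct layout.
set_option linter.dupNamespace false

noncomputable section

/-! ## 1. Generator types occur -/

/-- If the quotient `S ⧸ (S ∩ D)` has nonzero dimension then `S ≠ ⊥` (for `S = HWV_χ` and `D` the
decomposable part: a generator type is an occurring weight). [folklore] -/
theorem ne_bot_of_finrank_quotient_ne_zero {K V : Type*} [Field K] [AddCommGroup V] [Module K V]
    (S D : Submodule K V) (h : Module.finrank K (S ⧸ D.comap S.subtype) ≠ 0) : S ≠ ⊥ := by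
  intro hS
  apply h
  have htop : D.comap S.subtype = ⊤ := by
    rw [Submodule.comap_subtype_eq_top, hS]
    exact bot_le
  haveI : Subsingleton (S ⧸ D.comap S.subtype) := (Submodule.Quotient.subsingleton_iff).mpr htop
  exact Module.finrank_zero_of_subsingleton

/-! ## 2. Supports of dominant nonpositive weights versus an upper set -/

section Support

variable {σ τ : Type*} [Fintype σ] [Fintype τ] [LinearOrder τ]

/-- For a dominant nonpositive weight `χ` on a finite linear order, an injective `ι : σ → τ` onto an
UPPER set, and a nonzero entry `χ x ≠ 0` OFF `range ι`: the whole of `range ι` lies strictly inside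
the support of `χ` (supports of dominant nonpositive weights are upper sets, and two upper sets of a
linear order are nested), so `#range ι < #supp χ`. [folklore] -/
theorem card_image_lt_card_filter_ne_zero [DecidableEq τ] {ι : σ → τ}
    (hup : IsUpperSet (Set.range ι)) {χ : Weight τ} (hdom : χ.IsDominant) (hle : ∀ i, χ i ≤ 0)
    {x : τ} (hx : x ∉ Set.range ι) (hχx : χ x ≠ 0) :
    (Finset.univ.image ι).card < (Finset.univ.filter fun i => χ i ≠ 0).card := by
  have hsub : Finset.univ.image ι ⊆ Finset.univ.filter fun i => χ i ≠ 0 := by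
    intro y hy
    rw [Finset.mem_image] at hy
    obtain ⟨a, _, rfl⟩ := hy
    rw [Finset.mem_filter]
    refine ⟨Finset.mem_univ _, ?_⟩
    have hxa : x ≤ ι a := by
      by_contra hlt
      rw [not_le] at hlt
      exact hx (hup hlt.le ⟨a, rfl⟩)
    exact apply_ne_zero_of_le_of_isDominant hdom hle hxa hχx
  refine Finset.card_lt_card ((Finset.ssubset_iff_of_subset hsub).mpr ⟨x, ?_, ?_⟩)
  · rw [Finset.mem_filter]
    exact ⟨Finset.mem_univ _, hχx⟩
  · rw [Finset.mem_image]
    rintro ⟨a, _, rfl⟩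
    exact hx ⟨a, rfl⟩

omit [Fintype τ] [LinearOrder τ] in
/-- The image of `Finset.univ` under an injective map has the cardinality of the source. [folklore] -/
theorem card_image_univ_of_injective [DecidableEq τ] {ι : σ → τ} (hι : Function.Injective ι) :
    (Finset.univ.image ι).card = Fintype.card σ := by
  rw [Finset.card_image_of_injective _ hι, Finset.card_univ]

omit [LinearOrder τ] in
/-- If the support of `χ` has more elements than `σ`, some nonzero entry lies off the range of any
`ι : σ → τ`. [folklore] -/
theorem exists_not_mem_range_of_card_lt [DecidableEq τ] (ι : σ → τ) {χ : Weight τ}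
    (h : Fintype.card σ < (Finset.univ.filter fun i => χ i ≠ 0).card) :
    ∃ x, x ∉ Set.range ι ∧ χ x ≠ 0 := by
  by_contra hno
  push Not at hno
  have hsub : (Finset.univ.filter fun i => χ i ≠ 0) ⊆ Finset.univ.image ι := by
    intro y hy
    rw [Finset.mem_filter] at hy
    rw [Finset.mem_image]
    by_contra himg
    push Not at himg
    exact hy.2 (hno y (by rintro ⟨a, rfl⟩; exact himg a (Finset.mem_univ _) rfl))
  have h1 := Finset.card_le_card hsub
  have h2 : (Finset.univ.image ι).card ≤ Fintype.card σ := by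
    rw [← Finset.card_univ]; exact Finset.card_image_le
  omega

end Support

/-! ## 3. The wide regime of `ℂ[Δ_m[tr X_{m+e}^m]]` lives beyond degree `m²` -/

section Wide

variable {m e : ℕ}

/-- **A wide occurring weight has more than `m²` nonzero entries.** For `1 ≤ m`, a final segment
`ι : MatIdx m → MatIdx (m + e)` and a weight `χ` OCCURRING in `ℂ[Δ_m[tr X_{m+e}^m]]` with a nonzero
entry off `range ι`: `m² < #supp χ` (occurring weights are dominant and `≤ 0`, BLMW (5.2.2)).
[folklore] -/
theorem sq_lt_card_filter_ne_zero_of_wide {ι : MatIdx m → MatIdx (m + e)} (hι : StrictMono ι)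
    (hup : IsUpperSet (Set.range ι)) {χ : Weight (MatIdx (m + e))}
    (hocc : highestWeightSpace (orbitCoordRep (powFormLex ℂ (m + e) m) m) χ ≠ ⊥)
    (hwide : ∃ x, x ∉ Set.range ι ∧ χ x ≠ 0) :
    m * m < (Finset.univ.filter fun x => χ x ≠ 0).card := by
  classical
  haveI : Infinite ℂ := CharZero.infinite ℂ
  have h' : HasHighestWeight (orbitCoordRep (powFormLex ℂ (m + e) m) m) χ := hocc
  obtain ⟨hle, -⟩ := nonpos_and_exists_size_eq_of_hasHighestWeight_orbitCoordRep _ h'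
  have hdom := isDominant_of_hasHighestWeight_orbitCoordRep _ h'
  obtain ⟨x, hx, hχx⟩ := hwide
  have hlt := card_image_lt_card_filter_ne_zero hup hdom hle hx hχx
  rw [card_image_univ_of_injective hι.injective, Fintype.card_lex, Fintype.card_prod,
    Fintype.card_fin] at hlt
  exact hlt

/-- **Wide occurring weights have degree at least `m² + 1`**: with the hypotheses of
`sq_lt_card_filter_ne_zero_of_wide`, `-|χ| ≥ m · (m² + 1)` — by `ℓ(λ) ≤ deg` (tree
`card_filter_ne_zero_le_degree`, Macdonald I.8 Ex. 9, after the BLMW lift) the degree `-|χ|/m` is at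
least the number of nonzero entries. So the conclusion of `stub_wideGen`
(`-|χ| ≤ m · 2^((log₂ m + c₀)^c₀)`) is never met for a trivial reason: every wide generator type sits
in degree `> m²`. [cite: Macdonald1995, Ch. I §8 Example 9] -/
theorem wide_degree_ge (hm : 1 ≤ m) {ι : MatIdx m → MatIdx (m + e)} (hι : StrictMono ι)
    (hup : IsUpperSet (Set.range ι)) {χ : Weight (MatIdx (m + e))}
    (hocc : highestWeightSpace (orbitCoordRep (powFormLex ℂ (m + e) m) m) χ ≠ ⊥)
    (hwide : ∃ x, x ∉ Set.range ι ∧ χ x ≠ 0) :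
    (m : ℤ) * ((m * m + 1 : ℕ) : ℤ) ≤ -(Weight.size χ) := by
  classical
  haveI : Infinite ℂ := CharZero.infinite ℂ
  have h' : HasHighestWeight (orbitCoordRep (powFormLex ℂ (m + e) m) m) χ := hocc
  obtain ⟨-, D, hD⟩ := nonpos_and_exists_size_eq_of_hasHighestWeight_orbitCoordRep _ h'
  have hlen := card_filter_ne_zero_le_degree (powFormLex ℂ (m + e) m) (by omega)
    (powFormLex_isHomogeneous ℂ (m + e) m) hocc hD
  have hlt := sq_lt_card_filter_ne_zero_of_wide hι hup hocc hwide
  have hD' : m * m + 1 ≤ D := by omega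
  rw [hD, neg_neg]
  exact_mod_cast Nat.mul_le_mul_left m hD'

/-- The same in the stub's vocabulary: a wide GENERATOR TYPE (`γ_χ ≠ 0`) of `A(Δ_m[tr X_{m+e}^m])`
has degree `-|χ| ≥ m · (m² + 1) > m · m²`. [cite: Macdonald1995, Ch. I §8 Example 9] -/
theorem wide_genType_degree_gt_sq (hm : 1 ≤ m) {ι : MatIdx m → MatIdx (m + e)} (hι : StrictMono ι)
    (hup : IsUpperSet (Set.range ι)) {χ : Weight (MatIdx (m + e))}
    (hwide : ∃ x, x ∉ Set.range ι ∧ χ x ≠ 0)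
    (hγ : Module.finrank ℂ (↥(highestWeightSpace (orbitCoordRep (powFormLex ℂ (m + e) m) m) χ) ⧸
      Submodule.comap (highestWeightSpace (orbitCoordRep (powFormLex ℂ (m + e) m) m) χ).subtype
        (⨆ p : Weight (MatIdx (m + e)) × Weight (MatIdx (m + e)),
          ⨆ (_ : p.1 + p.2 = χ ∧ p.1 ≠ 0 ∧ p.2 ≠ 0),
          highestWeightSpace (orbitCoordRep (powFormLex ℂ (m + e) m) m) p.1 *
            highestWeightSpace (orbitCoordRep (powFormLex ℂ (m + e) m) m) p.2)) ≠ 0) :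
    (m : ℤ) * ((m * m : ℕ) : ℤ) < -(Weight.size χ) := by
  have hocc := ne_bot_of_finrank_quotient_ne_zero _ _ hγ
  have h := wide_degree_ge hm hι hup hocc hwide
  have hm0 : (0 : ℤ) < m := by exact_mod_cast hm
  have hstep : (m : ℤ) * ((m * m : ℕ) : ℤ) < (m : ℤ) * ((m * m + 1 : ℕ) : ℤ) :=
    mul_lt_mul_of_pos_left (by exact_mod_cast Nat.lt_succ_self _) hm0
  exact lt_of_lt_of_le hstep h

/-- **The wide regime is empty at the bottom size of the window**: for `e = 0` a final segment
`ι : MatIdx m → MatIdx (m + 0)` is onto, so no weight has a nonzero entry off `range ι`. [folklore] -/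
theorem not_wide_of_e_eq_zero {ι : MatIdx m → MatIdx (m + 0)} (hι : StrictMono ι)
    (χ : Weight (MatIdx (m + 0))) : ¬ ∃ x, x ∉ Set.range ι ∧ χ x ≠ 0 := by
  classical
  rintro ⟨x, hx, -⟩
  have hsurj : Function.Surjective ι := by
    have hbij := (Fintype.bijective_iff_injective_and_card ι).mpr ⟨hι.injective, by simp⟩
    exact hbij.2
  exact hx (hsurj x)

end Wide

/-! ## 4. The ι-free form of `stub_wideGen` -/

section IotaFree

/-- **`stub_wideGen` without the final segment.** The registered stub (left, verbatim) is
equivalent to: for every `c` there is `c₀` such that throughout the window every generator type `χ`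
of `A(Δ_m[tr X_{m+e}^m])` with MORE THAN `m²` NONZERO ENTRIES has `-|χ| ≤ m · 2^((log₂ m + c₀)^c₀)`.
(`⇒`: more than `m²` nonzero entries leave one off any `m²`-element range; `⇐`:
`sq_lt_card_filter_ne_zero_of_wide`.) [folklore] -/
theorem wideGen_iff_card :
    (∀ c : ℕ, ∃ c₀ : ℕ, ∀ m e : ℕ, 1 ≤ m → m + e ≤ 2 ^ ((Nat.log 2 m + c) ^ c) →
      ∀ ι : MatIdx m → MatIdx (m + e), StrictMono ι → IsUpperSet (Set.range ι) →
        ∀ χ : Weight (MatIdx (m + e)), (∃ x, x ∉ Set.range ι ∧ χ x ≠ 0) →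
          Module.finrank ℂ (↥(highestWeightSpace (orbitCoordRep (powFormLex ℂ (m + e) m) m) (χ)) ⧸ Submodule.comap (highestWeightSpace (orbitCoordRep (powFormLex ℂ (m + e) m) m) (χ)).subtype (⨆ p : Weight (MatIdx (m + e)) × Weight (MatIdx (m + e)), ⨆ (_ : p.1 + p.2 = (χ) ∧ p.1 ≠ 0 ∧ p.2 ≠ 0), highestWeightSpace (orbitCoordRep (powFormLex ℂ (m + e) m) m) p.1 * highestWeightSpace (orbitCoordRep (powFormLex ℂ (m + e) m) m) p.2)) ≠ 0 →
            -(Weight.size χ) ≤ (m : ℤ) * 2 ^ ((Nat.log 2 m + c₀) ^ c₀)) ↔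
    (∀ c : ℕ, ∃ c₀ : ℕ, ∀ m e : ℕ, 1 ≤ m → m + e ≤ 2 ^ ((Nat.log 2 m + c) ^ c) →
        ∀ χ : Weight (MatIdx (m + e)), m * m < (Finset.univ.filter fun x => χ x ≠ 0).card →
          Module.finrank ℂ (↥(highestWeightSpace (orbitCoordRep (powFormLex ℂ (m + e) m) m) (χ)) ⧸ Submodule.comap (highestWeightSpace (orbitCoordRep (powFormLex ℂ (m + e) m) m) (χ)).subtype (⨆ p : Weight (MatIdx (m + e)) × Weight (MatIdx (m + e)), ⨆ (_ : p.1 + p.2 = (χ) ∧ p.1 ≠ 0 ∧ p.2 ≠ 0), highestWeightSpace (orbitCoordRep (powFormLex ℂ (m + e) m) m) p.1 * highestWeightSpace (orbitCoordRep (powFormLex ℂ (m + e) m) m) p.2)) ≠ 0 →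
            -(Weight.size χ) ≤ (m : ℤ) * 2 ^ ((Nat.log 2 m + c₀) ^ c₀)) := by
  classical
  constructor
  · intro h c
    obtain ⟨c₀, hc₀⟩ := h c
    refine ⟨c₀, fun m e hm he χ hcard hγ => ?_⟩
    obtain ⟨ι, hι, hup⟩ := exists_finalSegment (n := m) (n' := m + e) (Nat.le_add_right m e)
    have hcard' : Fintype.card (MatIdx m) < (Finset.univ.filter fun x => χ x ≠ 0).card := by
      rw [Fintype.card_lex, Fintype.card_prod, Fintype.card_fin]; exact hcard
    exact hc₀ m e hm he ι hι hup χ (exists_not_mem_range_of_card_lt ι hcard') hγ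
  · intro h c
    obtain ⟨c₀, hc₀⟩ := h c
    refine ⟨c₀, fun m e hm he ι hι hup χ hwide hγ => ?_⟩
    exact hc₀ m e hm he χ
      (sq_lt_card_filter_ne_zero_of_wide hι hup (ne_bot_of_finrank_quotient_ne_zero _ _ hγ) hwide) hγ

end IotaFree

/-! ## 5. The split of K2 by support is lossless -/

section Split

/-- **K2 ⟺ `stub_sliceGen ∧ stub_wideGen`** (both stubs verbatim as registered for the line
`trace-side-regimes`).  `⇒`: the slice half is the landed `sliceGen_of_powGenDegreeQP`
(`size_extend`), the wide half is K2 with a hypothesis dropped.  `⇐` (the skeleton's composition):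
fix the final segment `ι`; a weight is either `ext_ι (χ ∘ ι)` (no nonzero entry off `range ι`) or
wide; take `c₀ = max` of the two exponents. [folklore] -/
theorem powGenDegreeQP_iff_slice_and_wide :
    PowGenDegreeQP ↔
    ((∀ c : ℕ, ∃ c₀ : ℕ, ∀ m e : ℕ, 1 ≤ m → m + e ≤ 2 ^ ((Nat.log 2 m + c) ^ c) →
      ∀ ι : MatIdx m → MatIdx (m + e), StrictMono ι → IsUpperSet (Set.range ι) →
        ∀ χ : Weight (MatIdx m),
          Module.finrank ℂ (↥(highestWeightSpace (orbitCoordRep (powFormLex ℂ (m + e) m) m) (Function.extend ι χ 0)) ⧸ Submodule.comap (highestWeightSpace (orbitCoordRep (powFormLex ℂ (m + e) m) m) (Function.extend ι χ 0)).subtype (⨆ p : Weight (MatIdx (m + e)) × Weight (MatIdx (m + e)), ⨆ (_ : p.1 + p.2 = (Function.extend ι χ 0) ∧ p.1 ≠ 0 ∧ p.2 ≠ 0), highestWeightSpace (orbitCoordRep (powFormLex ℂ (m + e) m) m) p.1 * highestWeightSpace (orbitCoordRep (powFormLex ℂ (m + e) m) m) p.2)) ≠ 0 →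
            -(Weight.size χ) ≤ (m : ℤ) * 2 ^ ((Nat.log 2 m + c₀) ^ c₀)) ∧
    (∀ c : ℕ, ∃ c₀ : ℕ, ∀ m e : ℕ, 1 ≤ m → m + e ≤ 2 ^ ((Nat.log 2 m + c) ^ c) →
      ∀ ι : MatIdx m → MatIdx (m + e), StrictMono ι → IsUpperSet (Set.range ι) →
        ∀ χ : Weight (MatIdx (m + e)), (∃ x, x ∉ Set.range ι ∧ χ x ≠ 0) →
          Module.finrank ℂ (↥(highestWeightSpace (orbitCoordRep (powFormLex ℂ (m + e) m) m) (χ)) ⧸ Submodule.comap (highestWeightSpace (orbitCoordRep (powFormLex ℂ (m + e) m) m) (χ)).subtype (⨆ p : Weight (MatIdx (m + e)) × Weight (MatIdx (m + e)), ⨆ (_ : p.1 + p.2 = (χ) ∧ p.1 ≠ 0 ∧ p.2 ≠ 0), highestWeightSpace (orbitCoordRep (powFormLex ℂ (m + e) m) m) p.1 * highestWeightSpace (orbitCoordRep (powFormLex ℂ (m + e) m) m) p.2)) ≠ 0 →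
            -(Weight.size χ) ≤ (m : ℤ) * 2 ^ ((Nat.log 2 m + c₀) ^ c₀))) := by
  constructor
  · intro hK2
    refine ⟨sliceGen_of_powGenDegreeQP hK2, fun c => ?_⟩
    obtain ⟨c₀, hc₀⟩ := hK2 c
    exact ⟨c₀, fun m e hm he _ι _hι _hup χ _hwide hγ => hc₀ m e hm he χ hγ⟩
  · rintro ⟨hslice, hwide⟩ c
    obtain ⟨c₁, h₁⟩ := hslice c
    obtain ⟨c₂, h₂⟩ := hwide c
    refine ⟨max c₁ c₂, fun m e hm he χ hγ => ?_⟩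
    obtain ⟨ι, hι, hup⟩ := exists_finalSegment (n := m) (n' := m + e) (Nat.le_add_right m e)
    -- window-exponent monotonicity `(L + c)^c ≤ (L + c')^{c'}` for `c ≤ c'` (the tree's
    -- `logLevel_mono`, inlined to keep the import cone inside this route)
    have hlp : ∀ (L : ℕ) {c c' : ℕ}, c ≤ c' → (L + c) ^ c ≤ (L + c') ^ c' := by
      intro L c c' h
      rcases Nat.eq_zero_or_pos (L + c') with h0 | hpos
      · have hc' : c' = 0 := by omega
        have hc : c = 0 := by omega
        subst hc'; subst hc; simp
      · exact (Nat.pow_le_pow_left (by omega) c).trans (Nat.pow_le_pow_right hpos h)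
    have hmono : (2 : ℤ) ^ ((Nat.log 2 m + c₁) ^ c₁) ≤ 2 ^ ((Nat.log 2 m + max c₁ c₂) ^ (max c₁ c₂)) :=
      pow_le_pow_right₀ (by norm_num) (hlp _ (le_max_left _ _))
    have hmono' : (2 : ℤ) ^ ((Nat.log 2 m + c₂) ^ c₂) ≤ 2 ^ ((Nat.log 2 m + max c₁ c₂) ^ (max c₁ c₂)) :=
      pow_le_pow_right₀ (by norm_num) (hlp _ (le_max_right _ _))
    by_cases hw : ∃ x, x ∉ Set.range ι ∧ χ x ≠ 0
    · exact (h₂ m e hm he ι hι hup χ hw hγ).trans (mul_le_mul_of_nonneg_left hmono' (by positivity))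
    · push Not at hw
      have hext : Function.extend ι (χ ∘ ι) 0 = χ := by
        funext x
        by_cases hx : ∃ j, ι j = x
        · obtain ⟨j, rfl⟩ := hx
          rw [hι.injective.extend_apply, Function.comp_apply]
        · rw [Function.extend_apply' _ _ _ hx, Pi.zero_apply]
          exact (hw x (fun hmem => hx hmem)).symm
      have hb := h₁ m e hm he ι hι hup (χ ∘ ι) (by rw [hext]; exact hγ)
      have hsize : Weight.size (χ ∘ ι) = Weight.size χ := by
        rw [← size_extend hι.injective (χ ∘ ι), hext]
      rw [hsize] at hb
      exact hb.trans (mul_le_mul_of_nonneg_left hmono (by positivity))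

end Split

end

end Summit.ValiantsHypothesis.ValiantsHypothesis.Theorems.GeneratorObstructions.PowGenDegreeQP
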